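import Summits.Ventures.PercRepro.LemmaBColouring

/-!
# Lemma B from a two-colouring with a small defect

`LemmaBColouring.lean` proves, for every two-colouring `χ` of the cube giving each crossing point
a colour different from its antipode's, the product form
`crossCount² ≤ (topBotCount + |infDefect|) · (topBotCount + |supDefect|)`
(`crossCount_sq_le_of_colouring`). This file draws the sharp arithmetic consequence: **Lemma B
holds as soon as the two defects are small enough** — `|infDefect| + |supDefect| ≤ 1`, or one
defect is empty and the other has at most two members (`crossCount_le_topBotCount_of_defects`).
The bound is exact: with `|infDefect| = |supDefect| = 1` (or one defect of size `3`) the product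
form only gives `crossCount ≤ topBotCount + 1`.

So, for a colouring whose defects come from a single special pair — e.g. in the near-dominant
regime `crossCount ≤ columnCount 0 + 1`, where the colouring «`C₁ ∪ {B̄}` versus its antipodes»
has at most one meet-defect `B̄ ⊓ Ȳ` and one join-defect `B̄ ⊔ Ȳ` per `{x₁, x₃}`-point `Y` — Lemma B
fails only if BOTH defects are present (`crossCount_le_topBotCount_of_not_both_defects`).
-/

namespace PercRepro

open Finset

section Defect

variable {S : Type*} [Fintype S] [DecidableEq S] {k r : ℕ}

/-- Arithmetic core: `b² ≤ (g + δ₁)(g + δ₂)` with `δ₁ + δ₂ ≤ 1`, or `δ₁ = 0 ∧ δ₂ ≤ 2`, or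
`δ₂ = 0 ∧ δ₁ ≤ 2`, forces `b ≤ g`. -/
theorem le_of_sq_le_mul_add_small {b g δ₁ δ₂ : ℕ} (h : b * b ≤ (g + δ₁) * (g + δ₂))
    (hδ : δ₁ + δ₂ ≤ 1 ∨ (δ₁ = 0 ∧ δ₂ ≤ 2) ∨ (δ₂ = 0 ∧ δ₁ ≤ 2)) : b ≤ g := by
  by_contra hlt
  have hlt' : g + 1 ≤ b := by omega
  have h1 : (g + 1) * (g + 1) ≤ b * b := Nat.mul_le_mul hlt' hlt'
  rcases hδ with hδ | ⟨h0, h2⟩ | ⟨h0, h2⟩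
  · -- δ₁ + δ₂ ≤ 1: one of them is 0 and the other ≤ 1
    have hcases : (δ₁ = 0 ∧ δ₂ ≤ 1) ∨ (δ₂ = 0 ∧ δ₁ ≤ 1) := by omega
    rcases hcases with ⟨h0, h2⟩ | ⟨h0, h2⟩
    · subst h0
      have : g * (g + δ₂) ≤ g * (g + 1) := Nat.mul_le_mul_left g (by omega)
      nlinarith
    · subst h0
      have : (g + δ₁) * g ≤ (g + 1) * g := Nat.mul_le_mul_right g (by omega)
      nlinarith
  · subst h0
    have : g * (g + δ₂) ≤ g * (g + 2) := Nat.mul_le_mul_left g (by omega)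
    nlinarith
  · subst h0
    have : (g + δ₁) * g ≤ (g + 2) * g := Nat.mul_le_mul_right g (by omega)
    nlinarith

/-- **Lemma B from a colouring with a small defect**: for an antipode-separating two-colouring
`χ` with `|infDefect| + |supDefect| ≤ 1`, or one defect empty and the other of size `≤ 2`,
`crossCount x c ≤ topBotCount c`. -/
theorem crossCount_le_topBotCount_of_defects (x : Fin r → Setoid (Fin k))
    (hx : Function.Injective x) (c : Config S → Setoid (Fin k)) (χ : Config S → Bool)
    (hcross : ∀ σ : Config S, IsCrossingPt x c σ → χ σ ≠ χ σᶜ)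
    (hδ : (infDefect x c χ).card + (supDefect x c χ).card ≤ 1 ∨
      ((infDefect x c χ).card = 0 ∧ (supDefect x c χ).card ≤ 2) ∨
      ((supDefect x c χ).card = 0 ∧ (infDefect x c χ).card ≤ 2)) :
    crossCount x c ≤ topBotCount c :=
  le_of_sq_le_mul_add_small (crossCount_sq_le_of_colouring x hx c χ hcross) hδ

/-- **Lemma B unless both defects are present**: if each defect of `χ` has at most one member,
Lemma B holds as soon as one of them is empty. -/
theorem crossCount_le_topBotCount_of_not_both_defects (x : Fin r → Setoid (Fin k))
    (hx : Function.Injective x) (c : Config S → Setoid (Fin k)) (χ : Config S → Bool)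
    (hcross : ∀ σ : Config S, IsCrossingPt x c σ → χ σ ≠ χ σᶜ)
    (h1 : (infDefect x c χ).card ≤ 1) (h2 : (supDefect x c χ).card ≤ 1)
    (h : infDefect x c χ = ∅ ∨ supDefect x c χ = ∅) :
    crossCount x c ≤ topBotCount c := by
  apply crossCount_le_topBotCount_of_defects x hx c χ hcross
  rcases h with h | h
  · left; rw [h, Finset.card_empty]; omega
  · left; rw [h, Finset.card_empty]; omega

end Defect

end PercRepro
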